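import Mathlib
import Summits.NavierStokesRegularity.NavierStokesRegularity.Theorems.TaoLadderRungTwoBreakOneShiftWindowResSlopeD
import Summits.NavierStokesRegularity.NavierStokesRegularity.Theorems.TaoLadderRungTwoBreakOneShiftWindowKrawczykSlope
import HarnessLib

/-!
# The one-shift window system, XLII: THE KRAWCZYK ROWS FROM DYADIC DATA — the preconditioned magnitudes
# `|S_r δ_rc − Σ_{r'} C_{r r'} N_{r' c}|` over the interval residual slope of part XLI and their row sums, as ONE Boolean
# `KrawD.check`, with the soundness theorem delivering the hypotheses `hMag` and `hrow` of part X
# `K1_of_residualSlope` (cell harvest/h2-tao-ladder, seat p2; rung1/KERNEL-CHEAP-REPLAY-SPEC.md §2 (Krawczyk file: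
# `[R] = I − S⁻¹ C [DG] S`, row sums), §8; support for K1(1) = `NoSurvivingDSSOne`, stmt-NavierStokesRegularity-20205)

MODEL lattice ODEs only (Tao 2016 §4 normal form on Tao's shift set `S`); nothing here is a statement about
the Navier–Stokes equations; no item is closed; no instance is evaluated here.

No division is performed: with the block scale `S_r ∈ Sbox_r`, `Sbox_r.lo > 0`, the magnitude
`Magnum_rc = |Sbox_r ⊗ δ_rc ⊖ Σ_{r'} C_{rr'} ⊗ Nb_{r'c}|` bounds `S_r · |δ_rc − (Σ C N)_rc / S_r|`, and the row test
`Σ_c Magnum_rc ≤ Z · Sbox_r.lo` gives `Σ_c Mag_rc ≤ Z` for `Mag_rc = Magnum_rc / S_r`.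
-/

-- the sub-problem namespace repeats the summit name by design (D-0017)
set_option linter.dupNamespace false

namespace Summit.NavierStokesRegularity.NavierStokesRegularity.Theorems

namespace DSSOneShift

open Set Finset
open Summit.NavierStokesRegularity.NavierStokesRegularity.Theorems.TaylorModelCert
open Summit.NavierStokesRegularity.NavierStokesRegularity.Theorems.CertificateGlueOn

/-! ### Data and the Boolean -/

/-- **The dyadic data of the Krawczyk rows**: the residual-slope data, the preconditioner `C` (row-major
`(n+1) × (n+1)` dyadics) and the contraction constant `Z`. [cite: Tao2016AveragedNS, §5.3; cell vocabulary, harvest/h2-tao-ladder rung1/KERNEL-CHEAP-REPLAY-SPEC.md §2 (Krawczyk file)] -/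
structure KrawD where
  /-- the residual-slope data (part XLI) -/
  rs : ResSlopeD
  /-- the preconditioner, row-major `(n+1)²` -/
  Cmat : Array Dyad
  /-- the contraction constant of (K1) -/
  ZD : Dyad

namespace KrawD

variable (k : KrawD)

/-- `n + 1` block coordinates. [folklore] -/
def N1 : ℕ := k.rs.n + 1

/-- Reader of a dyadic array (junk `0`). [folklore] -/
def dgetK (A : Array Dyad) (i : ℕ) : Dyad := if h : i < A.size then A[i] else Dyad.ofInt 0

/-- Preconditioner entry `C r r'`. [folklore] -/
def cget (r r' : ℕ) : Dyad := dgetK k.Cmat (r * k.N1 + r')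

/-- The block scale box `S_r` (`a` on a window coordinate, `r_τ` on the flight time). [folklore] -/
def Sbox (r : ℕ) : IntervalD := if r = k.rs.n then k.rs.rtau else IntervalD.aget k.rs.aBox r

/-- The interval residual slope, materialised column-major (`(r', c)` at `c · N1 + r'`). [folklore] -/
def NbA : Array IntervalD := Array.ofFn fun t : Fin (k.N1 * k.N1) => k.rs.Nb (t.val % k.N1) (t.val / k.N1)

/-- Entry `(r', c)` of the materialised residual slope. [folklore] -/
def nb (A : Array IntervalD) (r' c : ℕ) : IntervalD := IntervalD.aget A (c * k.N1 + r')

/-- The preconditioned magnitude `|Sbox_r δ_rc − Σ_{r'} C_{rr'} Nb_{r'c}|`. [cite: Tao2016AveragedNS, §5.3; cell vocabulary, harvest/h2-tao-ladder rung1/KERNEL-CHEAP-REPLAY-SPEC.md §2 ([R] = I − S⁻¹C[DG]S)] -/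
def magnum (A : Array IntervalD) (r c : ℕ) : Dyad :=
  IntervalD.mag (IntervalD.subR k.rs.prec (if r = c then k.Sbox r else IntervalD.ofInt 0)
    (IntervalD.rangeSumR k.rs.prec (fun r' => IntervalD.mulR k.rs.prec (IntervalD.ofDyad (k.cget r r')) (k.nb A r' c)) k.N1))

/-- Row test: `Σ_c Magnum_rc ≤ Z · Sbox_r.lo` and `Sbox_r.lo > 0`. [folklore] -/
def rowOK (A : Array IntervalD) (r : ℕ) : Bool :=
  Dyad.blt (Dyad.ofInt 0) (k.Sbox r).lo &&
  IntervalD.hiLe (IntervalD.rangeSumR k.rs.prec (fun c => IntervalD.ofDyad (k.magnum A r c)) k.N1) (k.ZD.mul (k.Sbox r).lo)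

/-- **THE KRAWCZYK-ROWS TEST.** [cite: Tao2016AveragedNS, §5.3; cell vocabulary, harvest/h2-tao-ladder rung1/KERNEL-CHEAP-REPLAY-SPEC.md §2 (row sums < ρ)] -/
def check : Bool :=
  let A := k.NbA
  Dyad.ble (Dyad.ofInt 0) k.ZD && (List.range k.N1).all fun r => k.rowOK A r

/-! ### Soundness -/

section Sound

variable {m : ℕ} (F : OneShiftFrame m) (e : Fin m × Fin F.W ≃ Fin k.rs.n)

/-- The flat numbering of the block coordinates as an equivalence. [folklore] -/
def eOE : F.WIdx ≃ Fin (k.rs.n + 1) := (Equiv.optionCongr e).trans finSuccEquivLast.symm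

/-- Its values are `eO`. [folklore] -/
theorem eOE_val (r : F.WIdx) : ((k.eOE F e r : Fin (k.rs.n + 1)) : ℕ) = k.rs.eO F e r := by
  rcases r with _ | p
  · simp [eOE, ResSlopeD.eO]
  · simp [eOE, ResSlopeD.eO]

/-- The real preconditioner matrix. [folklore] -/
noncomputable def CmatR (r r' : F.WIdx) : ℝ := (k.cget (k.rs.eO F e r) (k.rs.eO F e r')).toReal

/-- The real magnitude bound `Mag_rc = Magnum_rc / S_r`. [folklore] -/
noncomputable def MagR (r c : F.WIdx) : ℝ := (k.magnum k.NbA (k.rs.eO F e r) (k.rs.eO F e c)).toReal / F.bscale r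

/-- Reading the materialised residual slope. [folklore] -/
theorem nb_NbA (r' c : F.WIdx) : k.nb k.NbA (k.rs.eO F e r') (k.rs.eO F e c) = k.rs.Nb (k.rs.eO F e r') (k.rs.eO F e c) := by
  have hr := (k.eOE F e r').isLt
  have hc := (k.eOE F e c).isLt
  rw [eOE_val] at hr hc
  have hflat : k.rs.eO F e c * k.N1 + k.rs.eO F e r' < k.N1 * k.N1 ∧ (k.rs.eO F e c * k.N1 + k.rs.eO F e r') / k.N1 = k.rs.eO F e c ∧
      (k.rs.eO F e c * k.N1 + k.rs.eO F e r') % k.N1 = k.rs.eO F e r' := by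
    have hN : k.N1 = k.rs.n + 1 := rfl
    rw [hN]
    refine ⟨by nlinarith [Nat.mul_le_mul_right (k.rs.n + 1) (Nat.succ_le_of_lt hc)], ?_, ?_⟩
    · rw [add_comm, Nat.add_mul_div_right _ _ (Nat.succ_pos _), Nat.div_eq_of_lt hr, zero_add]
    · rw [add_comm, Nat.add_mul_mod_self_right, Nat.mod_eq_of_lt hr]
  obtain ⟨h1, h2, h3⟩ := hflat
  unfold nb NbA
  rw [IntervalD.aget_ofFn _ h1]
  dsimp only
  rw [h2, h3]

variable {hW1 : 1 < F.W} {hD : F.D < F.W} {g γ : ℝ} {z z' φ : Fin m → ℤ → ℝ}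
  {Umat : Matrix (Fin m × Fin F.W) (Fin m × Fin F.W) ℝ} {ρ Ttop : Fin m → ℝ}

/-- The block scale lies in its box. [folklore] -/
theorem mem_Sbox (M : k.rs.Matches F e hW1 hD g γ z z' φ Umat ρ Ttop) (r : F.WIdx) :
    IntervalD.mem (F.bscale r) (k.Sbox (k.rs.eO F e r)) := by
  rcases r with _ | ⟨i, j⟩
  · simp only [OneShiftFrame.bscale, Option.elim, Sbox, ResSlopeD.eO, if_true]; exact M.hrτ
  · simp only [OneShiftFrame.bscale, Option.elim, Sbox, ResSlopeD.eO]
    rw [if_neg (e (i, j)).isLt.ne]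
    exact M.ha i j

/-- **SOUNDNESS OF THE KRAWCZYK-ROWS TEST**: the hypotheses `hMag` (for every residual slope in the interval one)
and `hrow` of part X `K1_of_residualSlope`, with `Nlo/Nhi` the endpoints of part XLI's `Nb`, `Cmat` the data
preconditioner and `Mag = Magnum / S`. [cite: Tao2016AveragedNS, §5.3; Moore1979, §3.2; cell vocabulary, harvest/h2-tao-ladder rung1/KERNEL-CHEAP-REPLAY-SPEC.md §2 (Krawczyk file)] -/
theorem mag_row_of_check (M : k.rs.Matches F e hW1 hD g γ z z' φ Umat ρ Ttop) (hc : k.check = true) :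
    (∀ N : F.WIdx → F.WIdx → ℝ,
      (∀ r c, (k.rs.Nb (k.rs.eO F e r) (k.rs.eO F e c)).lo.toReal ≤ N r c ∧ N r c ≤ (k.rs.Nb (k.rs.eO F e r) (k.rs.eO F e c)).hi.toReal) →
      ∀ r c, |(if r = c then 1 else 0) - (∑ r', k.CmatR F e r r' * N r' c) / F.bscale r| ≤ k.MagR F e r c) ∧
    ∀ r, ∑ c, k.MagR F e r c ≤ k.ZD.toReal := by
  classical
  -- unpack
  have hc' : 0 ≤ k.ZD.toReal ∧ ∀ r < k.N1, k.rowOK k.NbA r = true := by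
    unfold check at hc
    simp only [Bool.and_eq_true, List.all_eq_true, List.mem_range] at hc
    exact ⟨by simpa using (Dyad.ble_iff _ _).1 hc.1, hc.2⟩
  obtain ⟨hZ0, hrows⟩ := hc'
  have hrowr : ∀ r : F.WIdx, 0 < (k.Sbox (k.rs.eO F e r)).lo.toReal ∧
      IntervalD.hiLe (IntervalD.rangeSumR k.rs.prec (fun c => IntervalD.ofDyad (k.magnum k.NbA (k.rs.eO F e r) c)) k.N1)
        (k.ZD.mul (k.Sbox (k.rs.eO F e r)).lo) = true := by
    intro r
    have hr := (k.eOE F e r).isLt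
    rw [eOE_val] at hr
    have h := hrows _ hr
    unfold rowOK at h
    simp only [Bool.and_eq_true] at h
    exact ⟨by simpa using (Dyad.blt_iff _ _).1 h.1, h.2⟩
  have hinj : ∀ r c : F.WIdx, (k.rs.eO F e r = k.rs.eO F e c) ↔ r = c := fun r c => by
    constructor
    · intro h
      have : (k.eOE F e r : ℕ) = (k.eOE F e c : ℕ) := by rw [eOE_val, eOE_val]; exact h
      exact (k.eOE F e).injective (Fin.ext this)
    · rintro rfl; rfl
  -- the magnitude bound for one entry
  have hmag : ∀ N : F.WIdx → F.WIdx → ℝ,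
      (∀ r c, (k.rs.Nb (k.rs.eO F e r) (k.rs.eO F e c)).lo.toReal ≤ N r c ∧ N r c ≤ (k.rs.Nb (k.rs.eO F e r) (k.rs.eO F e c)).hi.toReal) →
      ∀ r c, |F.bscale r * (if r = c then 1 else 0) - ∑ r', k.CmatR F e r r' * N r' c| ≤
        (k.magnum k.NbA (k.rs.eO F e r) (k.rs.eO F e c)).toReal := by
    intro N hN r c
    refine IntervalD.abs_le_mag ?_
    refine IntervalD.mem_subR k.rs.prec ?_ ?_
    · by_cases hrc : r = c
      · subst hrc; simp only [if_true, mul_one]; exact k.mem_Sbox F e M r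
      · rw [if_neg hrc, if_neg (fun h => hrc ((hinj r c).1 h)), mul_zero]; exact_mod_cast IntervalD.mem_ofInt 0
    · have hN1 : k.N1 = k.rs.n + 1 := rfl
      rw [hN1]
      refine mem_sum_equiv (k.eOE F e) k.rs.prec fun j hj => ?_
      have hval : k.rs.eO F e ((k.eOE F e).symm ⟨j, hj⟩) = j := by
        have := k.eOE_val F e ((k.eOE F e).symm ⟨j, hj⟩)
        rw [Equiv.apply_symm_apply] at this
        exact this.symm
      unfold CmatR
      have hnb := k.nb_NbA F e ((k.eOE F e).symm ⟨j, hj⟩) c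
      have hNj := hN ((k.eOE F e).symm ⟨j, hj⟩) c
      rw [hval] at hnb hNj
      rw [hval, hnb]
      exact IntervalD.mem_mulR k.rs.prec (IntervalD.mem_ofDyad _) ⟨hNj.1, hNj.2⟩
  refine ⟨fun N hN r c => ?_, fun r => ?_⟩
  · have hS := F.bscale_pos r
    have h1 := hmag N hN r c
    unfold MagR
    rw [le_div_iff₀ hS]
    have e1 : |(if r = c then (1 : ℝ) else 0) - (∑ r', k.CmatR F e r r' * N r' c) / F.bscale r| * F.bscale r =
        |F.bscale r * (if r = c then 1 else 0) - ∑ r', k.CmatR F e r r' * N r' c| := by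
      rw [← abs_of_pos hS, ← abs_mul, abs_of_pos hS]
      congr 1
      field_simp
    rw [e1]
    exact h1
  · obtain ⟨hSlo, hle⟩ := hrowr r
    have hS := F.bscale_pos r
    have hSmem := k.mem_Sbox F e M r
    -- Σ_c Magnum ≤ Z · Slo
    have hsum : ∑ c : F.WIdx, (k.magnum k.NbA (k.rs.eO F e r) (k.rs.eO F e c)).toReal ≤ k.ZD.toReal * (k.Sbox (k.rs.eO F e r)).lo.toReal := by
      have hm : IntervalD.mem (∑ c : F.WIdx, (k.magnum k.NbA (k.rs.eO F e r) (k.rs.eO F e c)).toReal)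
          (IntervalD.rangeSumR k.rs.prec (fun c => IntervalD.ofDyad (k.magnum k.NbA (k.rs.eO F e r) c)) k.N1) := by
        have hN1 : k.N1 = k.rs.n + 1 := rfl
        rw [hN1]
        refine mem_sum_equiv (k.eOE F e) k.rs.prec fun j hj => ?_
        have hval : k.rs.eO F e ((k.eOE F e).symm ⟨j, hj⟩) = j := by
          have := k.eOE_val F e ((k.eOE F e).symm ⟨j, hj⟩)
          rw [Equiv.apply_symm_apply] at this
          exact this.symm
        rw [hval]
        exact IntervalD.mem_ofDyad _
      have := IntervalD.le_of_hiLe hle hm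
      simpa [Dyad.toReal_mul] using this
    have hSlo_le : (k.Sbox (k.rs.eO F e r)).lo.toReal ≤ F.bscale r := hSmem.1
    calc ∑ c, k.MagR F e r c = (∑ c, (k.magnum k.NbA (k.rs.eO F e r) (k.rs.eO F e c)).toReal) / F.bscale r := by
          unfold MagR; rw [Finset.sum_div]
      _ ≤ (k.ZD.toReal * (k.Sbox (k.rs.eO F e r)).lo.toReal) / F.bscale r := by
          exact div_le_div_of_nonneg_right hsum hS.le
      _ ≤ k.ZD.toReal := by
          rw [div_le_iff₀ hS]
          exact mul_le_mul_of_nonneg_left hSlo_le hZ0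

end Sound

end KrawD

end DSSOneShift

end Summit.NavierStokesRegularity.NavierStokesRegularity.Theorems
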